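import Literature.AlgebraicGeometry.HodgeTheory.QuaternionicQuarticDoublePlaneChart
import Literature.AlgebraicGeometry.HodgeTheory.QuaternionicQuarticDeckChartAction
import HarnessLib

/-!
# The deck transformation `τ` on the double-plane chart: `(u, s, t) ↦ (u, −s, i·t)`; `τ² = ` the double-plane involution `t ↦ −t`

Layer `Literature/AlgebraicGeometry/HodgeTheory`. Definitions (`tauDPPoly`, `tauDP`) + proved API; no named fact. Sequel of
`QuaternionicQuarticDoublePlaneChart` (`DoublePlaneRing a = R[u₀,u₁,s,t]/(c − s²σc, t² − sαψ)`, `toDeck : s ↦ w₁/σc, t ↦ w/σc`) and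
of the tree's `QuaternionicQuarticDeckChartAction` (`tauHom : DeckRing a →ₐ[R] DeckRing a`, `τ₀ : (w, w₁, w₂) ↦ (iw, −w₁, −iw₂)`).
Written by the prover seat `leafhand-hodge-q8symplecticpowers-4` (g4, cell `pub-hsemireg`) for route `HodgeConjecture/Q8SymplecticPowers`
(crux K1Q, stmt-HodgeConjecture-24190): the eigen-`h^{2,0}` counts `(o)(o′)` of the member certificates LCERT₄ ∕ LCERT_{≥6}
(«no `τ²`-invariant `(2,0)`-forms, some anti-invariant one») are statements about the action recorded here — on the double plane,
**`τ²` IS the covering involution `t ↦ −t` of `t² = s·α·ψ` over the rational surface `{c = s²σc}`**, so `τ²`-invariant forms are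
forms of a rational surface.

* `tauDPPoly`, `tauDP : DoublePlaneRing a →ₐ[R] DoublePlaneRing a` — `u ↦ u`, `s ↦ −s`, `t ↦ i·t` (`i = iR R`); well defined:
  `c − s²σc ↦ c − s²σc`, `t² − sαψ ↦ −(t² − sαψ)`;
* **`toDeck_tauDP`** — equivariance of the bridge: `toDeck ∘ tauDP = tauHom ∘ toDeck` (`w₁/σc ↦ −w₁/σc`, `w/σc ↦ i·w/σc`);
* `tauDP_tauDP_mk_X2`, `tauDP_tauDP_mk_X3` — `τ²` fixes `u, s` and negates `t`: the double-plane involution;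
  `tauDP_pow_four` — `τ⁴ = 1`.

Honest scope: explicit commutative algebra; nothing here bears on HC; no Hodge-theoretic count is proved here.

## References

* [Kollar2007] J. Kollár, Lectures on Resolution of Singularities (2007), §3.3–§3.4.1 (the multiple planes and their deck group).
* [Naie2007] D. Naie, The irregularity of cyclic multiple planes after Zariski, Enseign. Math. 53 (2007), §1.1–§1.2 (the cyclic
  group acting on the normalised standard covering).
* [Zariski1929] O. Zariski, On the linear connection index of the algebraic surfaces zⁿ = f(x, y), PNAS 15 (1929).
-/

noncomputable section

open MvPolynomial

namespace Literature.AlgebraicGeometry.HodgeTheory.Q8Family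

universe v

section Tau

variable {R : Type v} [CommRing R] [Algebra ℂ R] {e : ℕ} (a : CIdx e → R)

/-- `τ` on `R[u₀, u₁, s, t]`: `(u₀, u₁, s, t) ↦ (u₀, u₁, −s, i·t)`. [cite: Kollar2007, §3.4.1] -/
def tauDPPoly (R : Type v) [CommRing R] [Algebra ℂ R] : MvPolynomial (Fin 4) R →ₐ[R] MvPolynomial (Fin 4) R :=
  aeval ![X 0, X 1, -X 2, C (iR R) * X 3]

/-- `τ` on `u₀`. [cite: Kollar2007, §3.4.1] -/
@[simp] theorem tauDPPoly_X0 : tauDPPoly R (X 0) = X 0 := by simp [tauDPPoly]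
/-- `τ` on `u₁`. [cite: Kollar2007, §3.4.1] -/
@[simp] theorem tauDPPoly_X1 : tauDPPoly R (X 1) = X 1 := by simp [tauDPPoly]
/-- `τ` on `s`. [cite: Kollar2007, §3.4.1] -/
@[simp] theorem tauDPPoly_X2 : tauDPPoly R (X 2) = -X 2 := by simp [tauDPPoly]
/-- `τ` on `t`. [cite: Kollar2007, §3.4.1] -/
@[simp] theorem tauDPPoly_X3 : tauDPPoly R (X 3) = C (iR R) * X 3 := by simp [tauDPPoly]

/-- `τ` fixes everything dehomogenised from `R[x₀, x₁, x₂]`. [cite: Kollar2007, §3.4.1] -/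
theorem tauDPPoly_dehom₄ (p : MvPolynomial (Fin 3) R) : tauDPPoly R (dehom₄ p) = dehom₄ p := by
  change ((tauDPPoly R).comp dehom₄) p = dehom₄ p
  congr 1
  refine MvPolynomial.algHom_ext fun i => ?_
  fin_cases i <;> simp [tauDPPoly, dehom₄]

/-- `τ c = c`. [cite: Kollar2007, §3.4.1] -/
@[simp] theorem tauDPPoly_c₄ : tauDPPoly R (c₄ a) = c₄ a := tauDPPoly_dehom₄ _
/-- `τ σc = σc`. [cite: Kollar2007, §3.4.1] -/
@[simp] theorem tauDPPoly_c₄' : tauDPPoly R (c₄' a) = c₄' a := tauDPPoly_dehom₄ _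
/-- `τ ψ = ψ`. [cite: Kollar2007, §3.4.1] -/
@[simp] theorem tauDPPoly_ψ₄ : tauDPPoly R (ψ₄ a) = ψ₄ a := tauDPPoly_dehom₄ _
/-- `τ α = α`. [cite: Kollar2007, §3.4.1] -/
@[simp] theorem tauDPPoly_α₄ : tauDPPoly R (α₄ : MvPolynomial (Fin 4) R) = α₄ := by
  simp only [α₄, map_sub, tauDPPoly_X0, tauDPPoly_X1]

/-- `(C i)² = −1` in `R[u₀, u₁, s, t]`. [cite: Kollar2007, §3.4.1] -/
theorem C_iR_sq₄ : (C (iR R) * C (iR R) : MvPolynomial (Fin 4) R) = -1 := by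
  rw [← C_mul, iR_mul_iR, C_neg, C_1]

/-- `τ` maps the two double-plane relations into the ideal: `c − s²σc ↦ c − s²σc`, `t² − sαψ ↦ −(t² − sαψ)`.
[cite: Kollar2007, §3.4.1] -/
theorem tauDPPoly_dpRel_mem (k : Fin 2) : tauDPPoly R (dpRel a k) ∈ dpIdeal a := by
  have h := C_iR_sq₄ (R := R)
  fin_cases k
  · refine mem_dpIdeal_of_eq a (u := 1) (u' := 0) ?_
    simp only [dpRel, map_sub, map_mul, map_pow, tauDPPoly_c₄, tauDPPoly_c₄', tauDPPoly_X2]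
    ring
  · refine mem_dpIdeal_of_eq a (u := 0) (u' := -1) ?_
    simp only [dpRel, map_sub, map_mul, map_pow, tauDPPoly_X3, tauDPPoly_X2, tauDPPoly_α₄, tauDPPoly_ψ₄]
    linear_combination (X 3 ^ 2 : MvPolynomial (Fin 4) R) * h

/-- The double-plane ideal is `τ`-stable. [cite: Kollar2007, §3.4.1] -/
theorem dpIdeal_le_comap_tauDPPoly : dpIdeal a ≤ (dpIdeal a).comap (tauDPPoly R) := by
  rw [dpIdeal, Ideal.span_le]
  rintro _ ⟨k, rfl⟩
  exact tauDPPoly_dpRel_mem a k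

/-- **`τ` on the double-plane chart ring**, `(u, s, t) ↦ (u, −s, i·t)`. [cite: Kollar2007, §3.4.1] -/
def tauDP : DoublePlaneRing a →ₐ[R] DoublePlaneRing a :=
  Ideal.quotientMapₐ (dpIdeal a) (tauDPPoly R) (dpIdeal_le_comap_tauDPPoly a)

/-- `tauDP` on classes. [cite: Kollar2007, §3.4.1] -/
@[simp] theorem tauDP_mk (p : MvPolynomial (Fin 4) R) :
    tauDP a (Ideal.Quotient.mk (dpIdeal a) p) = Ideal.Quotient.mk (dpIdeal a) (tauDPPoly R p) := rfl

/-- `τ` fixes the unit `1/σc = v c α ψ` of the deck chart. [cite: Kollar2007, §3.4.1] -/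
@[simp] theorem tauPoly_invC'U : tauPoly R (invC'U a) = invC'U a := by
  simp only [invC'U, map_mul, tauPoly_X5, tauPoly_cU, tauPoly_αU, tauPoly_ψU]

/-- **The bridge is `τ`-equivariant**: `toDeck (τ x) = τ (toDeck x)` (`w₁/σc ↦ −w₁/σc`, `w/σc ↦ i·w/σc`).
[cite: Kollar2007, §3.4.1] -/
theorem toDeck_tauDP (x : DoublePlaneRing a) : toDeck a (tauDP a x) = tauHom a (toDeck a x) := by
  obtain ⟨p, rfl⟩ := Ideal.Quotient.mk_surjective x
  change ((toDeck a).comp ((tauDP a).comp (Ideal.Quotient.mkₐ R (dpIdeal a)))) p =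
    ((tauHom a).comp ((toDeck a).comp (Ideal.Quotient.mkₐ R (dpIdeal a)))) p
  congr 1
  refine MvPolynomial.algHom_ext fun i => ?_
  fin_cases i
  · simp
  · simp
  · simp only [AlgHom.comp_apply, Ideal.Quotient.mkₐ_eq_mk, Fin.reduceFinMk, tauDP_mk, tauDPPoly_X2, map_neg, toDeck_mk,
      toDeckPoly_X2, tauHom_mk, map_mul, tauPoly_X3, tauPoly_invC'U]
    ring
  · simp only [AlgHom.comp_apply, Ideal.Quotient.mkₐ_eq_mk, Fin.reduceFinMk, tauDP_mk, tauDPPoly_X3, map_mul, algHom_C,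
      MvPolynomial.algebraMap_eq, toDeck_mk, toDeckPoly_X3, tauHom_mk, tauPoly_X2, tauPoly_invC'U, mul_assoc]

/-- `τ²` fixes `s`: `τ(τ s) = s`. [cite: Kollar2007, §3.4.1] -/
theorem tauDP_tauDP_mk_X2 :
    tauDP a (tauDP a (Ideal.Quotient.mk (dpIdeal a) (X 2))) = Ideal.Quotient.mk (dpIdeal a) (X 2) := by
  simp only [tauDP_mk, tauDPPoly_X2, map_neg, neg_neg]

/-- **`τ²` is the double-plane involution**: `τ(τ t) = −t` (and `τ²` fixes `u₀, u₁, s`). [cite: Zariski1929]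
[cite: Kollar2007, §3.4.1] -/
theorem tauDP_tauDP_mk_X3 :
    tauDP a (tauDP a (Ideal.Quotient.mk (dpIdeal a) (X 3))) = -Ideal.Quotient.mk (dpIdeal a) (X 3) := by
  have h := C_iR_sq₄ (R := R)
  have h3 : tauDPPoly R (tauDPPoly R (X 3)) = -X 3 := by
    simp only [tauDPPoly_X3, map_mul, algHom_C, MvPolynomial.algebraMap_eq]
    linear_combination (X 3 : MvPolynomial (Fin 4) R) * h
  rw [tauDP_mk, tauDP_mk, h3, map_neg]

/-- `τ⁴ = 1` on `R[u₀, u₁, s, t]`. [cite: Kollar2007, §3.4.1] -/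
theorem tauDPPoly_pow_four :
    (tauDPPoly R).comp ((tauDPPoly R).comp ((tauDPPoly R).comp (tauDPPoly R))) = AlgHom.id R _ := by
  have h := C_iR_sq₄ (R := R)
  refine MvPolynomial.algHom_ext fun i => ?_
  fin_cases i
  · simp
  · simp
  · simp
  · simp only [AlgHom.comp_apply, AlgHom.id_apply, Fin.reduceFinMk, tauDPPoly_X3, map_mul, algHom_C,
      MvPolynomial.algebraMap_eq]
    linear_combination ((C (iR R) * C (iR R) - 1) * X 3 : MvPolynomial (Fin 4) R) * h

/-- **`τ⁴ = 1` on the double-plane chart ring.** [cite: Kollar2007, §3.4.1] -/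
theorem tauDP_pow_four (x : DoublePlaneRing a) : tauDP a (tauDP a (tauDP a (tauDP a x))) = x := by
  obtain ⟨p, rfl⟩ := Ideal.Quotient.mk_surjective x
  have h := DFunLike.congr_fun (tauDPPoly_pow_four (R := R)) p
  simp only [AlgHom.comp_apply, AlgHom.id_apply] at h
  simp only [tauDP_mk, h]

end Tau

end Literature.AlgebraicGeometry.HodgeTheory.Q8Family

end
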